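import Summits.ValiantsHypothesis.ValiantsHypothesis.Theorems.DivisionGapPerDivisionHardStubTorus

/-!
# Crux `DivisionGap.PerDivisionHard` (stmt-ValiantsHypothesis-5065), line
`pair-descent-jss-endpoint` — stub `stub_torusSupport` (v2): the torus normal form is a sub-support

The sparse branch of the line (`perDivisionHard_sparse_of` in the v2 skeleton) needs the torus
normal form `h'` of `stub_torus` together with `supp h' ⊆ supp h`, so that a monomial count on the
cofactor survives the normalisation.  This is immediate from the landed proof
(`exists_topComponent_const_margins`, `Theorems/DivisionGapPerDivisionHardStubTorus.lean`): both
degeneration steps are top components, whose supports only shrink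
(`support_topComponent_subset`).  Same two steps, keeping the inclusions. [folklore]
-/

noncomputable section

-- `Summit.ValiantsHypothesis.ValiantsHypothesis.…` is the tree's mandated single-conjunct layout
-- (Sub = Summit), so the duplicated namespace component is intended.
set_option linter.dupNamespace false

namespace Summit.ValiantsHypothesis.ValiantsHypothesis.Theorems.DivisionGapPerDivisionHard

open MvPolynomial Literature.Computability.AlgebraicComplexity
open scoped NNReal

/-- **`stub_torusSupport`** (v2 stub of line `pair-descent-jss-endpoint`): every nonzero cofactor
`h ∈ ℝ≥0[x_ij]` has a nonzero TORUS-HOMOGENEOUS normal form `h'` whose support is contained in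
that of `h`, with `L(per_n · h') ≤ L(per_n · h)` and `L(h') ≤ L(h)` (monotone fan-in-two
`complexity` over `ℝ≥0`).  Two initial-form steps (rows, then columns) as in `stub_torus`.
[folklore] -/
theorem stub_torusSupport :
    ∀ (n : ℕ) (h : MvPolynomial (Fin n × Fin n) ℝ≥0), h ≠ 0 →
      ∃ h' : MvPolynomial (Fin n × Fin n) ℝ≥0, h' ≠ 0 ∧ IsTorusHomogeneous h' ∧
        h'.support ⊆ h.support ∧
        complexity (perPoly (Fin n) ℝ≥0 * h') ≤ complexity (perPoly (Fin n) ℝ≥0 * h) ∧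
        complexity h' ≤ complexity h := by
  intro n h hh
  -- row step: `per` is row-homogeneous since `i ↦ π i` is a bijection
  obtain ⟨h₁, hh₁, hsub₁, hrow, hle₁, hle₁'⟩ := exists_topComponent_const_margins Prod.fst
    (fun B π => Equiv.sum_comp π (fun a : Fin n => B ^ ((a : Fin n) : ℕ))) hh
  -- column step: `per` is column-homogeneous trivially
  obtain ⟨h₂, hh₂, hsub₂, hcol, hle₂, hle₂'⟩ :=
    exists_topComponent_const_margins Prod.snd (fun B π => rfl) hh₁
  obtain ⟨d₀, hd₀⟩ := exists_coeff_ne_zero hh₂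
  have hd₀s : d₀ ∈ h₂.support := mem_support_iff.mpr hd₀
  refine ⟨h₂, hh₂, ⟨rowDegrees d₀, Finsupp.mapDomain Prod.snd d₀, fun m hm => ⟨?_, ?_⟩⟩,
    hsub₂.trans hsub₁, hle₂.trans hle₁, hle₂'.trans hle₁'⟩
  · exact hrow m (hsub₂ hm) d₀ (hsub₂ hd₀s)
  · exact hcol m hm d₀ hd₀s

end Summit.ValiantsHypothesis.ValiantsHypothesis.Theorems.DivisionGapPerDivisionHard

end
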